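import Literature.Analysis.Distribution.FourierLaplaceBoundaryValue
import HarnessLib

/-!
# The boundary limit of the Fourier–Laplace transform of an arbitrary tempered distribution

Topic `Literature/Analysis/Distribution`, a complement to `FourierLaplaceBoundaryValue`. There the
boundary value `∫ F(x + ity) φ(x) dx → T(φ)` of `F = fourierLaplaceFun T S` (Streater–Wightman
Thm. 2-9) is proved in two steps: for every `T` the pairing at height `t` is
`u(χ_S e^{2πt⟨y,·⟩} 𝓕φ)`, `u = T ∘ 𝓕⁻¹`, and tends to `u(χ_S 𝓕φ)` because the Schwartz seminorms
of `χ_S (e^{2πt⟨y,·⟩} − 1) 𝓕φ` are `O(t)`; only the final identification `u(χ_S 𝓕φ) = T(φ)` uses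
the hypothesis that `u` is supported in `S`. This file records the first step on its own
(`tendsto_integral_fourierLaplaceFun_rayPoint_mul_smulLeft`): **for every tempered distribution
`T` and every set `S`, `∫ F(x + ity) φ(x) dx → u(χ_S · 𝓕φ)` as `t → 0⁺`**, `y` in the open cone
`interior S⁻` (the proof is that of `tendsto_integral_fourierLaplaceFun_rayPoint_mul` with the last
step removed). It is the form needed when `F(z) = u(χ_S e^{−2πi⟨z,·⟩})` is used for a distribution
`u` *not* known to be supported in `S` — e.g. the annihilator of a space of Laplace transforms in
the density argument of Osterwalder–Schrader I (1973), Lemma 8.2.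

## References

* R. F. Streater, A. S. Wightman, *PCT, Spin and Statistics, and All That*, §2-3, Thm. 2-9.
  [StreaterWightman1964]
* K. Osterwalder, R. Schrader, *Axioms for Euclidean Green's functions*, Comm. Math. Phys. 31
  (1973) 83–112, Lemma 8.2. [OsterwalderSchraderCMP1973]
-/

noncomputable section

open Set Filter Metric SchwartzMap MeasureTheory
open _root_.Complex (exp I)
open scoped ContDiff Topology RealInnerProductSpace SchwartzMap FourierTransform

namespace Literature.Analysis.Distribution

variable {ι : Type*} [Fintype ι]

/-- **The boundary limit of the Fourier–Laplace transform of an arbitrary tempered distribution**: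
for every `T`, every set `S` and `y ∈ interior S⁻`,
`∫ F(x + ity) φ(x) dx → u(χ_S · 𝓕φ)` as `t → 0⁺`, where `F = fourierLaplaceFun T S` and
`u = T ∘ 𝓕⁻¹` (Streater–Wightman (1964), proof of Thm. 2-9, without the support hypothesis).
[cite: StreaterWightman1964, Thm 2-9] -/
theorem tendsto_integral_fourierLaplaceFun_rayPoint_mul_smulLeft (T : 𝓢(EuclideanSpace ℝ ι, ℂ) →L[ℂ] ℂ)
    (S : Set (EuclideanSpace ℝ ι)) {y : EuclideanSpace ℝ ι} (hy : y ∈ interior (polarCone S))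
    (φ : 𝓢(EuclideanSpace ℝ ι, ℂ)) :
    Tendsto (fun t : ℝ => ∫ x, fourierLaplaceFun T S (rayPoint x y t) * φ x)
      (𝓝[>] 0) (𝓝 (fourierInvDual T
        (SchwartzMap.smulLeftCLM ℂ (fun ξ => (coneCutoff S ξ : ℂ)) (𝓕 φ)))) := by
  -- `u` is bounded by finitely many seminorms
  obtain ⟨k₀, n₀, Cu, hCu, hu⟩ := exists_bound_seminorm_clm (fourierInvDual T)
  -- geometry at `y`: `⟪y, ξ⟫ ≤ 3(r + R)` on the support of the cutoff
  obtain ⟨r, R, hr, hR, -, hgeo⟩ := exists_forall_inner_le_of_subset_interior_polarCone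
    (S := S) isCompact_singleton (singleton_subset_iff.2 hy)
  set A' : ℝ := 2 * Real.pi * (3 * (r + R)) with hA'
  have hA'0 : 0 ≤ A' := by positivity
  -- constants
  set κ : ℝ := 2 * Real.pi * Fintype.card ι with hκ
  have hκ0 : 0 ≤ κ := by positivity
  set ψ : 𝓢(EuclideanSpace ℝ ι, ℂ) := 𝓕 φ with hψ
  set K₀ : 𝓢(EuclideanSpace ℝ ι, ℂ) := SchwartzMap.smulLeftCLM ℂ (fun ξ => (coneCutoff S ξ : ℂ)) ψ
    with hK₀
  -- the seminorm bound constants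
  set E : ℕ × ℕ → ℝ := fun m => 4 ^ m.2 * coneCutoffBound S m.2 * (κ * ‖y‖) * Real.exp A' *
    (2 ^ (m.1 + 1) * (Finset.Iic (m.1 + 1, m.2)).sup
      (fun m' => SchwartzMap.seminorm ℂ m'.1 m'.2) ψ) with hE
  have hE0 : ∀ m, 0 ≤ E m := fun m => by
    have := coneCutoffBound_nonneg S m.2
    positivity
  set t₁ : ℝ := min 1 (1 / (κ * ‖y‖ + 1)) with ht₁
  have ht₁0 : 0 < t₁ := by positivity
  -- the key estimate for `0 < t ≤ t₁`
  have hkey : ∀ t : ℝ, 0 < t → t ≤ t₁ →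
      ‖(∫ x, fourierLaplaceFun T S (rayPoint x y t) * φ x) - fourierInvDual T K₀‖ ≤
        Cu * (∑ m ∈ Finset.Iic (k₀, n₀), E m) * t := by
    intro t ht htt
    have ht1 : t ≤ 1 := htt.trans (min_le_left _ _)
    have h0 : imVec (rayPoint 0 y t) ∈ interior (polarCone S) := by
      rw [imVec_rayPoint]; exact smul_mem_interior_polarCone hy ht
    set ℓ' := expForm (rayPoint (0 : EuclideanSpace ℝ ι) y t) with hℓ'
    -- `‖ℓ'‖ ≤ κ t ‖y‖ ≤ 1`
    have hℓ'n : ‖ℓ'‖ ≤ κ * (t * ‖y‖) := by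
      refine (norm_expForm_le _).trans ?_
      have h := norm_rayPoint_le (0 : EuclideanSpace ℝ ι) y t
      rw [norm_zero, zero_add, abs_of_pos ht] at h
      exact mul_le_mul_of_nonneg_left h hκ0
    have hℓ'1 : ‖ℓ'‖ ≤ 1 := by
      have h2 : t ≤ 1 / (κ * ‖y‖ + 1) := htt.trans (min_le_right _ _)
      rw [le_div_iff₀ (by positivity)] at h2
      nlinarith [norm_nonneg y]
    -- `Re ℓ' ≤ A'` on the support of the cutoff
    have hℓ're : ∀ ξ ∈ tsupport (coneCutoff S), (ℓ' ξ).re ≤ A' := by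
      intro ξ hξ
      rw [hℓ', re_expForm_apply, imVec_rayPoint, real_inner_smul_left]
      have h1 := hgeo y (mem_singleton _) ξ (tsupport_coneCutoff_subset S hξ)
      have h2 : ⟪y, ξ⟫ ≤ 3 * (r + R) := by nlinarith [norm_nonneg ξ]
      have h3 : t * ⟪y, ξ⟫ ≤ 1 * (3 * (r + R)) := by
        rcases le_or_gt 0 ⟪y, ξ⟫ with h | h
        · exact mul_le_mul ht1 h2 h zero_le_one
        · nlinarith
      nlinarith [Real.pi_pos]
    -- the difference `K_t − K₀` and its pointwise form
    set Kt : 𝓢(EuclideanSpace ℝ ι, ℂ) := SchwartzMap.pairing (ContinuousLinearMap.mul ℂ ℂ)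
      (laplaceKernel S (rayPoint 0 y t)) ψ with hKt
    have hfun : ⇑(Kt - K₀) = fun ξ => (coneCutoff S ξ : ℂ) * (exp (ℓ' ξ) - 1) * ψ ξ := by
      funext ξ
      rw [sub_apply, hKt, SchwartzMap.pairing_apply_apply, ContinuousLinearMap.mul_apply', hK₀,
        SchwartzMap.smulLeftCLM_apply_apply (hasTemperateGrowth_coneCutoff S),
        laplaceKernel_apply h0, smul_eq_mul]
      ring
    -- seminorm bound `O(t)`
    have hsemi : ∀ m : ℕ × ℕ, SchwartzMap.seminorm ℂ m.1 m.2 (Kt - K₀) ≤ E m * t := by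
      intro m
      refine SchwartzMap.seminorm_le_bound ℂ m.1 m.2 _ (mul_nonneg (hE0 m) ht.le) fun ξ => ?_
      rw [hfun]
      have hBψ : ∀ i ≤ m.2, ‖iteratedFDeriv ℝ i ψ ξ‖ ≤ 2 ^ (m.1 + 1) *
          (Finset.Iic (m.1 + 1, m.2)).sup (fun m' => SchwartzMap.seminorm ℂ m'.1 m'.2) ψ /
            (1 + ‖ξ‖) ^ (m.1 + 1) := by
        intro i hi
        have h := one_add_le_sup_seminorm_apply (𝕜 := ℂ) (m := (m.1 + 1, m.2)) le_rfl hi ψ ξ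
        rw [le_div_iff₀ (by positivity)]
        calc ‖iteratedFDeriv ℝ i ψ ξ‖ * (1 + ‖ξ‖) ^ (m.1 + 1)
            = (1 + ‖ξ‖) ^ (m.1 + 1) * ‖iteratedFDeriv ℝ i ψ ξ‖ := mul_comm _ _
          _ ≤ _ := h
      have h := norm_iteratedFDeriv_cutoff_sub_one_mul_le (contDiff_coneCutoff S)
        (fun i hi x => norm_iteratedFDeriv_coneCutoff_le S hi x) ℓ' hℓ're hℓ'1 (ψ.smooth ⊤) ξ hBψ
      have hsup0 : 0 ≤ (Finset.Iic (m.1 + 1, m.2)).sup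
          (fun m' => SchwartzMap.seminorm ℂ m'.1 m'.2) ψ := apply_nonneg _ _
      have hCn := coneCutoffBound_nonneg S m.2
      have hξ1 : ‖ξ‖ ^ m.1 * (1 + ‖ξ‖) ≤ (1 + ‖ξ‖) ^ (m.1 + 1) := by
        rw [pow_succ]
        gcongr
        linarith [norm_nonneg ξ]
      calc ‖ξ‖ ^ m.1 * ‖iteratedFDeriv ℝ m.2
            (fun ξ => (coneCutoff S ξ : ℂ) * (exp (ℓ' ξ) - 1) * ψ ξ) ξ‖
          ≤ ‖ξ‖ ^ m.1 * (4 ^ m.2 * coneCutoffBound S m.2 * ‖ℓ'‖ * (1 + ‖ξ‖) *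
              Real.exp (max A' 0) * (2 ^ (m.1 + 1) *
                (Finset.Iic (m.1 + 1, m.2)).sup (fun m' => SchwartzMap.seminorm ℂ m'.1 m'.2) ψ /
                  (1 + ‖ξ‖) ^ (m.1 + 1))) := mul_le_mul_of_nonneg_left h (by positivity)
        _ = 4 ^ m.2 * coneCutoffBound S m.2 * ‖ℓ'‖ * Real.exp (max A' 0) * (2 ^ (m.1 + 1) *
              (Finset.Iic (m.1 + 1, m.2)).sup (fun m' => SchwartzMap.seminorm ℂ m'.1 m'.2) ψ) *
              (‖ξ‖ ^ m.1 * (1 + ‖ξ‖) / (1 + ‖ξ‖) ^ (m.1 + 1)) := by ring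
        _ ≤ 4 ^ m.2 * coneCutoffBound S m.2 * ‖ℓ'‖ * Real.exp (max A' 0) * (2 ^ (m.1 + 1) *
              (Finset.Iic (m.1 + 1, m.2)).sup (fun m' => SchwartzMap.seminorm ℂ m'.1 m'.2) ψ) * 1 :=
            mul_le_mul_of_nonneg_left ((div_le_one (by positivity)).2 hξ1) (by positivity)
        _ ≤ 4 ^ m.2 * coneCutoffBound S m.2 * (κ * (t * ‖y‖)) * Real.exp (max A' 0) *
              (2 ^ (m.1 + 1) * (Finset.Iic (m.1 + 1, m.2)).sup
                (fun m' => SchwartzMap.seminorm ℂ m'.1 m'.2) ψ) * 1 := by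
            gcongr
        _ = E m * t := by
            simp only [hE, max_eq_left hA'0]
            ring
    -- conclusion of the key estimate
    rw [integral_fourierLaplaceFun_rayPoint_mul T S hy ht φ, ← map_sub]
    refine (hu _).trans ?_
    rw [mul_assoc]
    refine mul_le_mul_of_nonneg_left ?_ hCu
    refine Seminorm.finset_sup_apply_le (mul_nonneg (Finset.sum_nonneg fun m _ => hE0 m) ht.le)
      fun m hm => ?_
    rw [schwartzSeminormFamily_apply]
    calc SchwartzMap.seminorm ℂ m.1 m.2 (Kt - K₀) ≤ E m * t := hsemi m
      _ ≤ (∑ m' ∈ Finset.Iic (k₀, n₀), E m') * t := by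
          gcongr
          exact Finset.single_le_sum (fun m' _ => hE0 m') hm
  -- the limit
  set C : ℝ := Cu * ∑ m ∈ Finset.Iic (k₀, n₀), E m with hC
  have hC0 : 0 ≤ C := mul_nonneg hCu (Finset.sum_nonneg fun m _ => hE0 m)
  rw [Metric.tendsto_nhdsWithin_nhds]
  intro ε hε
  refine ⟨min t₁ (ε / (C + 1)), lt_min ht₁0 (by positivity), fun t ht hdist => ?_⟩
  rw [mem_Ioi] at ht
  rw [dist_zero_right, Real.norm_of_nonneg ht.le] at hdist
  rw [dist_eq_norm]
  calc ‖(∫ x, fourierLaplaceFun T S (rayPoint x y t) * φ x) - fourierInvDual T K₀‖ ≤ C * t :=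
        hkey t ht (hdist.le.trans (min_le_left _ _))
    _ ≤ C * (ε / (C + 1)) := by
        gcongr
        exact hdist.le.trans (min_le_right _ _)
    _ < ε := by
        rw [mul_div_assoc', div_lt_iff₀ (by positivity)]
        nlinarith

/-- **If the Fourier–Laplace transform of `u` relative to `S` vanishes on the tube, then `u`
annihilates `χ_S · ψ` for every Schwartz `ψ`** (boundary limit along a ray with `ψ = 𝓕φ`;
the Fourier transform is onto). [folklore] -/
theorem fourierInvDual_smulLeft_coneCutoff_eq_zero (T : 𝓢(EuclideanSpace ℝ ι, ℂ) →L[ℂ] ℂ)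
    (S : Set (EuclideanSpace ℝ ι)) {y : EuclideanSpace ℝ ι} (hy : y ∈ interior (polarCone S))
    (hF : ∀ (x : EuclideanSpace ℝ ι) (t : ℝ), 0 < t → fourierLaplaceFun T S (rayPoint x y t) = 0)
    (ψ : 𝓢(EuclideanSpace ℝ ι, ℂ)) :
    fourierInvDual T (SchwartzMap.smulLeftCLM ℂ (fun ξ => (coneCutoff S ξ : ℂ)) ψ) = 0 := by
  set φ : 𝓢(EuclideanSpace ℝ ι, ℂ) := 𝓕⁻ ψ with hφ
  have hψ : 𝓕 φ = ψ := by rw [hφ]; exact FourierTransform.fourier_fourierInv_eq ψ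
  have hlim := tendsto_integral_fourierLaplaceFun_rayPoint_mul_smulLeft T S hy φ
  rw [hψ] at hlim
  have hzero : (fun t : ℝ => ∫ x, fourierLaplaceFun T S (rayPoint x y t) * φ x) =ᶠ[𝓝[>] 0]
      fun _ => (0 : ℂ) := by
    filter_upwards [self_mem_nhdsWithin] with t ht
    simp [hF _ t ht]
  exact tendsto_nhds_unique (hlim.congr' hzero) tendsto_const_nhds

end Literature.Analysis.Distribution
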